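import Summits.RiemannHypothesis.RiemannHypothesis.Theorems.ThetaTier1Bridge
import Summits.RiemannHypothesis.RiemannHypothesis.Theorems.ThetaTier1Constants
import Summits.RiemannHypothesis.RiemannHypothesis.Theorems.WeilColumnBSplineIrwinHallBridge
import HarnessLib

/-!
# THETA tier-1 — the BRIDGE, main theorems (THETA-ASSIGN (AR); cc-s2-1, WEIL typing lane; RH-FREE bookkeeping)

Continues `ThetaTier1Bridge.lean` (`ofRow`, the four named hypotheses, `loss_le`): the gain side (`P.Ilo 16 = I_exact ≥ I_lo`
under `RtopHyp`), admissibility from the side conditions, and the main theorems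

* `loss_lt_gain_of_realCert (hq : 2 ≤ r.q) (hc : r.RealCert) (hZ : ZetaHyp r.m) (hΛ : LambdaHyp r.m) (hχ : ChiHyp r)
  (hR : RtopHyp r) : (ofRow r).Admissible r.qn ∧ (ofRow r).loss (1/2^r.k) < (ofRow r).gain 16`, `loss_lt_gain_of_checkAll`;
* with the constants of `ThetaTier1Constants` (`ζ(4)`, `ζ(5)`, `Σ Λ n⁻⁵`): `zetaHyp_four`, `lambdaHyp_four`; with
  handoff-prove-2's Irwin–Hall bridge `WeilColumnBSplineIrwinHallBridge` (`Rtop_eq_IH`, `chiL_eq_IH`, `chiL_nonneg`):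
  `rtopHyp`, `chiHyp`; hence the HYPOTHESIS-FREE arithmetic half of THETA-ASSIGN for the `m = 4` rows (all tier-1 rows):
  **`loss_lt_gain_of_realCert_four (hm : r.m = 4) (hq : 2 ≤ r.q) (hc : r.RealCert) :
  (ofRow r).Admissible r.qn ∧ (ofRow r).loss (1/2^r.k) < (ofRow r).gain 16`** and `loss_lt_gain_of_checkAll_four`.

Nothing here bears on the truth of RH.
-/

set_option linter.dupNamespace false  -- the mandated namespace repeats `RiemannHypothesis`
set_option autoImplicit false

namespace Summit.RiemannHypothesis.RiemannHypothesis.Theorems.ThetaTier1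

open Summit.RiemannHypothesis.RiemannHypothesis.Theorems.WeilColumn.ThetaMellin

noncomputable section

/-! ## The gain side -/

/-- The recursive `gainSum` is a `Finset` sum. [this cell] -/
theorem gainSum_eq_sum (m : ℕ) (d : ℚ) (J : ℕ) : ∀ n, gainSum m d J n = ∑ j ∈ Finset.range n, gainTerm m d J j
  | 0 => by simp [gainSum]
  | n + 1 => by rw [gainSum, gainSum_eq_sum m d J n, Finset.sum_range_succ]

/-- D8: under `RtopHyp`, `P.Ilo 16 = I_exact` (the checker's exact Riemann sum, cast). [this cell] -/
theorem Ilo_eq (r : Row) (hR : RtopHyp r) : (ofRow r).Ilo JSTEPS = ((r.IloExact : ℚ) : ℝ) := by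
  simp only [ThetaParams.Ilo, Row.IloExact, gainSum_eq_sum, ofRow_δ, Rat.cast_mul, Rat.cast_sum, Rat.cast_ofNat]
  congr 1
  refine Finset.sum_congr rfl fun j _ => ?_
  have e1 := hR ((r.delta * j / JSTEPS - (r.delta * j / JSTEPS) * (r.delta * j / JSTEPS) / 2) / (2 * r.delta))
  have e2 := hR ((2 * r.delta - r.delta * (j + 1) / JSTEPS -
      (2 * r.delta - r.delta * (j + 1) / JSTEPS) * (2 * r.delta - r.delta * (j + 1) / JSTEPS) / 2) / (2 * r.delta))
  simp only [gainTerm, Rat.cast_mul, Rat.cast_div, Rat.cast_natCast]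
  push_cast at e1 e2
  rw [show ((r.delta : ℝ) * j / (JSTEPS : ℕ) - ((r.delta : ℝ) * j / (JSTEPS : ℕ)) ^ 2 / 2) / (2 * r.delta) =
      ((r.delta : ℝ) * j / (JSTEPS : ℕ) - (r.delta : ℝ) * j / (JSTEPS : ℕ) * ((r.delta : ℝ) * j / (JSTEPS : ℕ)) / 2) / (2 * r.delta)
      by ring, e1]
  rw [show ((2 * (r.delta : ℝ) - r.delta * (j + 1) / (JSTEPS : ℕ)) - (2 * (r.delta : ℝ) - r.delta * (j + 1) / (JSTEPS : ℕ)) ^ 2 / 2) /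
        (2 * r.delta) = ((2 * (r.delta : ℝ) - r.delta * (j + 1) / (JSTEPS : ℕ)) -
        (2 * (r.delta : ℝ) - r.delta * (j + 1) / (JSTEPS : ℕ)) * (2 * (r.delta : ℝ) - r.delta * (j + 1) / (JSTEPS : ℕ)) / 2) /
        (2 * r.delta) by ring, e2]

/-- D8/D9: `r.gain ≤ P.gain 16`. [this cell] -/
theorem gain_le (r : Row) (hq : 2 ≤ r.q) (hR : RtopHyp r) : r.gain ≤ (ofRow r).gain JSTEPS := by
  obtain ⟨-, -, -, -, -, -, -, -, -, -, -, -, -, -, -, -, -, -, -, h19, -⟩ := r.vals_table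
  rw [r.loss_gain.2, r.env_39, h19, ThetaParams.gain, Ilo_eq r hR, ofRow_q]
  have hl : 0 ≤ Real.log r.q := Real.log_nonneg (by exact_mod_cast (by omega : 1 ≤ r.q))
  have hI : ((r.Ilo : ℚ) : ℝ) ≤ ((r.IloExact : ℚ) : ℝ) := by exact_mod_cast r.Ilo_le_IloExact
  push_cast
  nlinarith

/-! ## Admissibility and the main theorem -/

/-- The side conditions `4 ≤ m`, `0 < δ`, `2δ < 7/80`, `e^{2δ}q < q⁺`, `e^{2δ} < 2` (and `2 ≤ q`) give `Admissible`.
[this cell, THETA-ASSIGN §1] -/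
theorem admissible_of_conds (r : Row) (hq : 2 ≤ r.q) (hm4 : 4 ≤ r.m) (hd : 0 < r.delta) (heps : 2 * r.delta < 7 / 80)
    (hwin : Real.exp (2 * (r.delta : ℝ)) * r.q < r.qn) (he2 : Real.exp (2 * (r.delta : ℝ)) < 2) :
    (ofRow r).Admissible r.qn := by
  have hd' : (0 : ℝ) < r.delta := by exact_mod_cast hd
  have heps' : 2 * (r.delta : ℝ) < 7 / 80 := by
    have h' : ((2 * r.delta : ℚ) : ℝ) < ((7 / 80 : ℚ) : ℝ) := Rat.cast_lt.2 heps
    push_cast at h'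
    exact h'
  have hlog : Real.log 2 ≤ Real.log r.q := Real.log_le_log (by norm_num) (by exact_mod_cast hq)
  have hl2 := Real.log_two_gt_d9
  exact
    { three_le := by simp only [ofRow_m]; omega
      delta_pos := hd'
      window := by simpa using hwin
      exp_lt_two := by simpa using he2
      eta_pos := by norm_num
      eta_lt := by simp only [ThetaParams.a, ofRow_η, ofRow_q, ofRow_δ]; linarith
      c₁_pos := by norm_num
      c₂_pos := by norm_num
      seed₁ := by simp only [ThetaParams.ε, ofRow_c₁, ofRow_m₀, ofRow_δ, ofRow_c₂]; linarith
      seed₂ := by simp only [ThetaParams.ε, ofRow_m₀, ofRow_δ, ofRow_c₂]; linarith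
      eps_small₁ := by simp only [ThetaParams.ε, ofRow_c₁, ofRow_m₀, ofRow_δ, ofRow_c₂]; linarith
      eps_small₂ := by simp only [ThetaParams.ε, ofRow_m₀, ofRow_δ, ofRow_c₂]; linarith }

/-- The side conditions of a certified row give `Admissible`. [this cell, THETA-ASSIGN §1] -/
theorem admissible_ofRow (r : Row) (hq : 2 ≤ r.q) (hc : r.RealCert) : (ofRow r).Admissible r.qn := by
  obtain ⟨-, hm4, -, hd, heps, hwin, he2, -⟩ := hc
  exact admissible_of_conds r hq hm4 hd heps hwin he2

/-- **(AR) of THETA-ASSIGN, modulo the four named hypotheses**: a row certified in the kernel gives the analytic layer's input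
`Admissible ∧ loss (2^{-k}) < gain 16` over `ThetaParams`. [this cell, THETA-ASSIGN  2] -/
theorem loss_lt_gain_of_realCert (r : Row) (hq : 2 ≤ r.q) (hc : r.RealCert) (hZ : ZetaHyp r.m) (hΛ : LambdaHyp r.m)
    (hχ : ChiHyp r) (hR : RtopHyp r) :
    (ofRow r).Admissible r.qn ∧ (ofRow r).loss (1 / 2 ^ r.k) < (ofRow r).gain JSTEPS :=
  ⟨admissible_ofRow r hq hc,
    (loss_le hq hc hZ hΛ hχ).trans_lt (hc.2.2.2.2.2.2.2.trans_le (gain_le r hq hR))⟩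

/-- The same from a passing `checkAll` list. [this cell, THETA-ASSIGN  2] -/
theorem loss_lt_gain_of_checkAll {rows : List Row} (h : checkAll rows = true) (r : Row) (hr : r ∈ rows) (hq : 2 ≤ r.q)
    (hZ : ZetaHyp r.m) (hΛ : LambdaHyp r.m) (hχ : ChiHyp r) (hR : RtopHyp r) :
    (ofRow r).Admissible r.qn ∧ (ofRow r).loss (1 / 2 ^ r.k) < (ofRow r).gain JSTEPS :=
  loss_lt_gain_of_realCert r hq (checkAll_sound h r hr) hZ hΛ hχ hR


/-! ## All four hypotheses discharged (`m = 4` for the constants; any `m ≥ 1` for the B-spline identities) -/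

/-- **`ZetaHyp 4`** from `ThetaTier1Constants`. [this cell] -/
theorem zetaHyp_four : ZetaHyp 4 := ⟨zetaTail_five_le, zetaTail_four_le⟩

/-- **`LambdaHyp 4`** from `ThetaTier1Constants`. [this cell] -/
theorem lambdaHyp_four : LambdaHyp 4 := vonMangoldtSum_five_le

/-- **`RtopHyp r`** from handoff-prove-2's Irwin–Hall bridge (`ThetaParams.Rtop_eq_IH`). [this cell] -/
theorem rtopHyp (r : Row) (hm : 1 ≤ r.m) : RtopHyp r := fun τ => (ofRow r).Rtop_eq_IH hm τ

/-- **`ChiHyp r`** (with equality) from handoff-prove-2's Irwin–Hall bridge (`ThetaParams.chiL_eq_IH`, `chiL_nonneg`). [this cell] -/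
theorem chiHyp (r : Row) (hm : 1 ≤ r.m) : ChiHyp r := by
  refine ⟨(ofRow r).chiL_nonneg hm (by norm_num), le_of_eq ?_⟩
  rw [(ofRow r).chiL_eq_IH hm (d := r.delta) (e := ETA) rfl (by norm_num [ETA]) (by norm_num [ETA])]
  rfl

/-- **THETA-ASSIGN (AR), hypothesis-free for the tier-1 rows (`m = 4`)**: a certified row gives the analytic layer's input
`Admissible ∧ loss (2^{-k}) < gain 16` over `ThetaParams`. [this cell, THETA-ASSIGN §2] -/
theorem loss_lt_gain_of_realCert_four (r : Row) (hm : r.m = 4) (hq : 2 ≤ r.q) (hc : r.RealCert) :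
    (ofRow r).Admissible r.qn ∧ (ofRow r).loss (1 / 2 ^ r.k) < (ofRow r).gain JSTEPS :=
  loss_lt_gain_of_realCert r hq hc (hm ▸ zetaHyp_four) (hm ▸ lambdaHyp_four) (chiHyp r (by omega)) (rtopHyp r (by omega))

/-- The same from a passing `checkAll` list (the data modules' `_check` theorems). [this cell, THETA-ASSIGN §2] -/
theorem loss_lt_gain_of_checkAll_four {rows : List Row} (h : checkAll rows = true) (r : Row) (hr : r ∈ rows)
    (hm : r.m = 4) (hq : 2 ≤ r.q) :
    (ofRow r).Admissible r.qn ∧ (ofRow r).loss (1 / 2 ^ r.k) < (ofRow r).gain JSTEPS :=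
  loss_lt_gain_of_realCert_four r hm hq (checkAll_sound h r hr)

end

end Summit.RiemannHypothesis.RiemannHypothesis.Theorems.ThetaTier1
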